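import Summits.QuantumFields.YangMills.Theorems.UnitScaleTiltProp7NestedMeanPoincare
import HarnessLib

/-!
# Route `UnitScaleTilt`, crux K1 child «MinimiserStabilityRegPr» (stmt-QuantumFields-19200), skeleton v10, stub `stub_existenceMinimalOrbit` (EX), route (α) —
# **R2a (Q1), THE COMB-SMALLNESS SOCKET** (sibling of ✓`Prop7NestedMeanPoincare`, same namespace): the block Poincaré inequality `‖toL2S l‖² ≤ 2·‖D^η_{U₀}(toL2S l)‖²` from the
# hypothesis the tower induction R2a′ actually delivers — «on every top block the COMB mean of `l` is `δ`-small relative to its block mass»,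
# `‖Σ_r Ad_{U₀(Γ_{ȳ,x_{y,r}})} l(x_{y,r})‖ ≤ δ·Σ_r‖l(x_{y,r})‖` — rather than through an explicit reference family `Φ` (✓`…_of_refMean_eq_zero` is the case `comb − Φ`).
# R2a′ = «`ns_k l = 0` ⇒ this hypothesis with `δ = 2Σ_{j<k}η_j`» (induction down the tower: `‖ns_j(z) − Ad_{h_{j,z}}(comb mean_j)‖ ≤ δ_j·mass_j`, `η_j` the level-`j`
# averaged-stair-vs-comb closeness) plugs here (ym3-torus-px20 g0, ★w5-20520 g7's R2 plan v2, «MINE R2a′» 18:16Z).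

Cell `ym3-torus`, width seat `ym3-torus-px20` (gen 0).  THEOREMS ONLY (0 `def`, 0 `sorry`).  `--supports stmt-QuantumFields-19200 --as helper`, count-neutral.  YM₃ on T³ is a ladder
rung (R3), not the Clay problem; nothing here claims the stub, the crux, d = 4 or the mass gap.

WHAT IS PROVED (sorry-free, no definition): ★★`sum_normSq_le_covGrad_of_combMean_small` (any `P i i′ e N`: `N d³((L^e)²a)² + Nδ² ≤ ½` + comb means `δ`-small ⇒
`Σ‖f‖² ≤ (N∕2)(L^e)²Σ‖∇^Vf‖²`, over ✓`sum_normSq_le_combMean_add_covGrad`); ★★★`normSq_toL2S_le_two_mul_of_combMean_small` (T³ member, brick L0a letters, `108ε² + 4δ² ≤ 1`).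
HONEST SCOPE: finite sums and the dictionary of the parent file; R2a′ not here; nothing of print asserted; no stub ∕ crux statement advanced.

References: T. Bałaban, CMP 99 (1985) 389–434 [Balaban1985BackgroundPropagators] (Thm 3.11 p.416, (3.3) p.391); CMP 89 (1983) 571–597 [Balaban1983RegularityDecay] ((2.27) p.580);
CMP 98 (1985) 17–51 [Balaban1985Averaging] (pp.24–25).
-/

set_option autoImplicit false

noncomputable section

open scoped BigOperators Matrix.Norms.L2Operator InnerProductSpace

namespace Summit.QuantumFields.YangMills.Theorems.Prop7NestedMeanPoincare

open Literature.MathematicalPhysics.QuantumFieldTheory.Balaban1983to89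
open Finset B1RG242Torus
open B7Prop1Explicit (treeWord plaqWord U1)
open B7Eq78Linearization (conjR conjR_apply conjR_sub)
open B8Ineq132 (norm_conjR)
open B10Eq27TorusAxialLog (holT unitsField toUField val_unitsField)
open B5Leaf237C0Torus (bsite sum_bsite sum_chart)
open Summit.QuantumFields.YangMills.Theorems.Prop7CovariantCoercivity (block_poincare_comb hyp_of_specialUnitary sum_norm_sq_le_mul_opNorm_sq)

variable {N : ℕ} [NeZero N]

/-! ## The comb-mean-smallness socket -/

section AppendV11

variable {P : Params} {i i' e : ℕ}

/-- ★★ **SMALL-FIELD FORM ON «COMB MEANS `δ`-SMALL»** (the socket of R2a′): if the plaquette variables of `V` are within `a` of `1`, `N d³((L^e)²a)² + Nδ² ≤ ½`, and on every block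
the comb mean of `f` is small relative to the block mass, `‖Σ_r Ad_{V(Γ_{ȳ,x_r})} f(x_r)‖ ≤ δ·Σ_r‖f(x_r)‖`, then `Σ_x‖f x‖² ≤ (N∕2)(L^e)²·Σ_νΣ_x‖(∇^V_νf)(x)‖²`.  (The reference-mean
form ✓`sum_normSq_le_covGrad_of_refMean_eq_zero` is the case `comb − Φ`; R2a′ delivers THIS hypothesis from `ns_k l = 0` by an induction down the tower.)
[cite: Balaban1985BackgroundPropagators, Thm 3.11 p.416; Balaban1983RegularityDecay, (2.27) p.580] -/
theorem sum_normSq_le_covGrad_of_combMean_small {V : GaugeField P i (Matrix (Fin N) (Fin N) ℂ)ˣ} (hV : ∀ b, V b ∈ U1 (Matrix (Fin N) (Fin N) ℂ))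
    {a δ : ℝ} (ha : 0 ≤ a) (hδ : 0 ≤ δ)
    (hplaq : ∀ (x : Site P i) (κ μ : Fin P.d), κ ≠ μ → ‖((holT V x (plaqWord κ μ) : (Matrix (Fin N) (Fin N) ℂ)ˣ) : Matrix (Fin N) (Fin N) ℂ) - 1‖ ≤ a)
    (hsmall : N * P.d ^ 3 * (((P.L : ℝ) ^ e) ^ 2 * a) ^ 2 + N * δ ^ 2 ≤ 1 / 2)
    (h : P.sitesPerDir i = P.L ^ e * P.sitesPerDir i') (f : Site P i → Matrix (Fin N) (Fin N) ℂ)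
    (hcomb : ∀ y : Site P i', ‖∑ r : Fin P.d → Fin (P.L ^ e),
        conjR (holT V (Site.fibreSite i e y fun _ => ⟨0, pow_pos P.L_pos e⟩) (treeWord fun ν => ((r ν : ℕ) : ℤ))) (f (Site.fibreSite i e y r))‖
      ≤ δ * ∑ r : Fin P.d → Fin (P.L ^ e), ‖f (Site.fibreSite i e y r)‖) :
    ∑ x : Site P i, ‖f x‖ ^ 2 ≤ (N / 2) * ((P.L : ℝ) ^ e) ^ 2 * ∑ ν : Fin P.d, ∑ x : Site P i, ‖conjR (V ⟨x, ν⟩) (f (x.shift ν)) - f x‖ ^ 2 := by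
  have hmain := sum_normSq_le_combMean_add_covGrad hV ha hplaq h f
  have hcard : (Fintype.card (Fin P.d → Fin (P.L ^ e)) : ℝ) = ((P.L : ℝ) ^ e) ^ P.d := by
    rw [Fintype.card_fun, Fintype.card_fin, Fintype.card_fin]; push_cast; ring
  -- per block: square the smallness and Cauchy–Schwarz
  have hblock : ∀ y : Site P i', ‖∑ r : Fin P.d → Fin (P.L ^ e),
      conjR (holT V (Site.fibreSite i e y fun _ => ⟨0, pow_pos P.L_pos e⟩) (treeWord fun ν => ((r ν : ℕ) : ℤ))) (f (Site.fibreSite i e y r))‖ ^ 2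
        ≤ δ ^ 2 * ((P.L : ℝ) ^ e) ^ P.d * ∑ r : Fin P.d → Fin (P.L ^ e), ‖f (Site.fibreSite i e y r)‖ ^ 2 := by
    intro y
    have h0 : 0 ≤ δ * ∑ r : Fin P.d → Fin (P.L ^ e), ‖f (Site.fibreSite i e y r)‖ :=
      mul_nonneg hδ (Finset.sum_nonneg fun _ _ => norm_nonneg _)
    have h1 := pow_le_pow_left₀ (norm_nonneg _) (hcomb y) 2
    have h2 : (∑ r : Fin P.d → Fin (P.L ^ e), ‖f (Site.fibreSite i e y r)‖) ^ 2
        ≤ Fintype.card (Fin P.d → Fin (P.L ^ e)) * ∑ r : Fin P.d → Fin (P.L ^ e), ‖f (Site.fibreSite i e y r)‖ ^ 2 := by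
      have := sq_sum_le_card_mul_sum_sq (s := (Finset.univ : Finset (Fin P.d → Fin (P.L ^ e)))) (f := fun r => ‖f (Site.fibreSite i e y r)‖)
      simpa using this
    rw [hcard] at h2
    calc _ ≤ (δ * ∑ r : Fin P.d → Fin (P.L ^ e), ‖f (Site.fibreSite i e y r)‖) ^ 2 := h1
      _ = δ ^ 2 * (∑ r : Fin P.d → Fin (P.L ^ e), ‖f (Site.fibreSite i e y r)‖) ^ 2 := by ring
      _ ≤ δ ^ 2 * (((P.L : ℝ) ^ e) ^ P.d * ∑ r : Fin P.d → Fin (P.L ^ e), ‖f (Site.fibreSite i e y r)‖ ^ 2) := mul_le_mul_of_nonneg_left h2 (sq_nonneg _)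
      _ = _ := by ring
  have hsumB : ∑ y : Site P i', ‖∑ r : Fin P.d → Fin (P.L ^ e),
      conjR (holT V (Site.fibreSite i e y fun _ => ⟨0, pow_pos P.L_pos e⟩) (treeWord fun ν => ((r ν : ℕ) : ℤ))) (f (Site.fibreSite i e y r))‖ ^ 2
        ≤ δ ^ 2 * ((P.L : ℝ) ^ e) ^ P.d * ∑ x : Site P i, ‖f x‖ ^ 2 := by
    refine (Finset.sum_le_sum fun y _ => hblock y).trans (le_of_eq ?_)
    rw [← Finset.mul_sum, sum_chart P h (fun x => ‖f x‖ ^ 2)]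
  have hLpos : (0 : ℝ) < ((P.L : ℝ) ^ e) ^ P.d := by have := P.L_pos; positivity
  have hm : (N : ℝ) * (((P.L : ℝ) ^ e) ^ P.d)⁻¹ * ∑ y : Site P i', ‖∑ r : Fin P.d → Fin (P.L ^ e),
      conjR (holT V (Site.fibreSite i e y fun _ => ⟨0, pow_pos P.L_pos e⟩) (treeWord fun ν => ((r ν : ℕ) : ℤ))) (f (Site.fibreSite i e y r))‖ ^ 2
        ≤ N * δ ^ 2 * ∑ x : Site P i, ‖f x‖ ^ 2 := by
    have h1 := mul_le_mul_of_nonneg_left hsumB (by positivity : (0 : ℝ) ≤ N * (((P.L : ℝ) ^ e) ^ P.d)⁻¹)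
    refine h1.trans (le_of_eq ?_)
    field_simp
  have hS0 : 0 ≤ ∑ x : Site P i, ‖f x‖ ^ 2 := Finset.sum_nonneg fun _ _ => sq_nonneg _
  have hG0 : 0 ≤ ∑ ν : Fin P.d, ∑ x : Site P i, ‖conjR (V ⟨x, ν⟩) (f (x.shift ν)) - f x‖ ^ 2 :=
    Finset.sum_nonneg fun _ _ => Finset.sum_nonneg fun _ _ => sq_nonneg _
  have h2 := mul_le_mul_of_nonneg_right hsmall hS0
  nlinarith [hmain, hm, h2, hG0]

end AppendV11

section AppendV11T3

open Literature.MathematicalPhysics.QuantumFieldTheory.Balaban1983to89.T3ContinuumYM3Torus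
open T3SectALandauChart (eta eta_pos)
open Summit.QuantumFields.YangMills.Theorems.Prop7SectET3Transport (bondEquiv bgOfCfg val_bgOfCfg isUnitaryBg_bgOfCfg)
open Summit.QuantumFields.YangMills.Theorems.Prop7SectET3HilbertLetters (W₂ toL2 toL2S DL2 inner_toL2 DL2_apply)

variable (F : T3Family) {n K : ℕ}

/-- ★★★ **R2a, COMB-SMALLNESS FORM — THE SOCKET R2a′ FEEDS.**  At the T³ member, `dist1(U₀(∂p)) ≤ ε·L^{−2(K−n)}`, `108ε² + 4δ² ≤ 1`: if on every top block the comb mean of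
`l` is `δ`-small relative to its block mass, `‖Σ_r Ad_{U₀(Γ_{ȳ,x_{y,r}})} l(x_{y,r})‖ ≤ δ·Σ_r‖l(x_{y,r})‖`, then **`‖toL2S l‖² ≤ 2·‖D^η_{U₀}(toL2S l)‖²`**.  R2a′ (the tower induction «`ns_k l = 0`
⇒ this hypothesis with `δ = 2Σ_{j<k}η_j`, `η_j` the level-`j` averaged-stair-vs-comb closeness») plugs here. [cite: Balaban1985BackgroundPropagators, Thm 3.11 p.416, (3.3) p.391; Balaban1983RegularityDecay, (2.27) p.580; Balaban1985Averaging, pp.24–25] -/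
theorem normSq_toL2S_le_two_mul_of_combMean_small {c₀ : ℝ} [Fact (0 < c₀)] (U₀ : GaugeField (F.P K) 0 (Matrix.specialUnitaryGroup (Fin 2) ℂ))
    {ε δ : ℝ} (hε : 0 ≤ ε) (hδ : 0 ≤ δ) (hwin : 108 * ε ^ 2 + 4 * δ ^ 2 ≤ 1)
    (hU : ∀ p : Plaq (F.P K) 0, dist1 (GaugeField.plaqHol U₀ p) ≤ ε * (((F.L : ℝ) ^ (K - n)) ^ 2)⁻¹)
    (l : Site (F.P K) 0 → Matrix (Fin 2) (Fin 2) ℂ)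
    (hcomb : ∀ y : Site (F.P K) (K - n), ‖∑ r : Fin (F.P K).d → Fin ((F.P K).L ^ (K - n)),
        conjR (holT (unitsField (toUField U₀)) (Site.fibreSite 0 (K - n) y fun _ => ⟨0, pow_pos (F.P K).L_pos (K - n)⟩)
          (treeWord fun ν => ((r ν : ℕ) : ℤ))) (l (Site.fibreSite 0 (K - n) y r))‖
      ≤ δ * ∑ r : Fin (F.P K).d → Fin ((F.P K).L ^ (K - n)), ‖l (Site.fibreSite 0 (K - n) y r)‖) :
    ‖toL2S F K c₀ l‖ ^ 2 ≤ 2 * ‖DL2 F n K c₀ U₀ (toL2S F K c₀ l)‖ ^ 2 := by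
  obtain ⟨hV, hplaq⟩ := hyp_of_specialUnitary U₀ hU
  have hc : 0 < c₀ := Fact.out
  have hLF : ((F.P K).L : ℝ) = (F.L : ℝ) := by norm_cast
  have hd : ((F.P K).d : ℝ) = 3 := by norm_num [T3ContinuumYM3Torus.T3Family.P_d]
  have hLpos : (0 : ℝ) < F.L := by have := F.hL.2; exact_mod_cast (by omega : 0 < F.L)
  have hL0 : (0 : ℝ) < ((F.L : ℝ) ^ (K - n)) ^ 2 := by positivity
  have hsmall : ((2 : ℕ) : ℝ) * (F.P K).d ^ 3 * ((((F.P K).L : ℝ) ^ (K - n)) ^ 2 * (ε * (((F.L : ℝ) ^ (K - n)) ^ 2)⁻¹)) ^ 2 + ((2 : ℕ) : ℝ) * δ ^ 2 ≤ 1 / 2 := by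
    rw [hLF, hd]
    have e1 : ((F.L : ℝ) ^ (K - n)) ^ 2 * (ε * (((F.L : ℝ) ^ (K - n)) ^ 2)⁻¹) = ε := by
      rw [mul_comm ε, ← mul_assoc, mul_inv_cancel₀ hL0.ne', one_mul]
    rw [e1]
    push_cast
    nlinarith [hwin]
  have hgen := sum_normSq_le_covGrad_of_combMean_small hV (by positivity) hδ hplaq hsmall (Prop7FlatCoercivity.sitesPerDir_T3 F n K) l hcomb
  rw [hLF] at hgen
  have hη : 0 < eta F n K := eta_pos F n K
  have hηL : (eta F n K)⁻¹ = (F.L : ℝ) ^ (K - n) := by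
    rw [T3SectALandauChart.eta, ← inv_pow, inv_inv]
  have eG : ∑ ν : Fin (F.P K).d, ∑ x : Site (F.P K) 0, ‖conjR (unitsField (toUField U₀) ⟨x, ν⟩) (l (x.shift ν)) - l x‖ ^ 2
      = ∑ b : PBond (F.P K) 0,
        ‖((U₀ b : Matrix.specialUnitaryGroup (Fin 2) ℂ) : Matrix (Fin 2) (Fin 2) ℂ) * l b.tgt * star (((U₀ b : Matrix.specialUnitaryGroup (Fin 2) ℂ) : Matrix (Fin 2) (Fin 2) ℂ)) - l b.src‖ ^ 2 := by
    rw [B10StarCount.sum_pbond, Finset.sum_comm]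
    refine Finset.sum_congr rfl fun ν _ => Finset.sum_congr rfl fun x _ => ?_
    rw [conjR_unitsField_toUField]
    rfl
  have hgrad := mul_sum_normSq_covGrad_le_normSq_DL2 F (n := n) (c₀ := c₀) U₀ l
  rw [hηL, ← eG] at hgrad
  have h1 := normSq_toL2S_le_two_mul F (K := K) (c₀ := c₀) l
  have h2 : 2 * c₀ * ∑ x : Site (F.P K) 0, ‖l x‖ ^ 2
      ≤ 2 * c₀ * (((2 : ℕ) : ℝ) / 2 * ((F.L : ℝ) ^ (K - n)) ^ 2 *
          ∑ ν : Fin (F.P K).d, ∑ x : Site (F.P K) 0, ‖conjR (unitsField (toUField U₀) ⟨x, ν⟩) (l (x.shift ν)) - l x‖ ^ 2) :=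
    mul_le_mul_of_nonneg_left hgen (by positivity)
  have h3 : 2 * c₀ * (((2 : ℕ) : ℝ) / 2 * ((F.L : ℝ) ^ (K - n)) ^ 2 *
          ∑ ν : Fin (F.P K).d, ∑ x : Site (F.P K) 0, ‖conjR (unitsField (toUField U₀) ⟨x, ν⟩) (l (x.shift ν)) - l x‖ ^ 2)
      = 2 * (c₀ * (((F.L : ℝ) ^ (K - n)) ^ 2 *
          ∑ ν : Fin (F.P K).d, ∑ x : Site (F.P K) 0, ‖conjR (unitsField (toUField U₀) ⟨x, ν⟩) (l (x.shift ν)) - l x‖ ^ 2)) := by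
    push_cast; ring
  rw [h3] at h2
  linarith [h1, h2, hgrad]

end AppendV11T3

end Summit.QuantumFields.YangMills.Theorems.Prop7NestedMeanPoincare

end
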